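import Summits.QuantumFields.YangMills.Theorems.UnitScaleTiltProp7CoverTwistedChart
import Summits.QuantumFields.YangMills.Theorems.UnitScaleTiltProp7SymAvgTwOfRegPr
import Summits.QuantumFields.YangMills.Theorems.UnitScaleTiltProp7SectET3CombLettersT3
import Summits.QuantumFields.YangMills.Theorems.UnitScaleTiltProp7ChartWindows
import HarnessLib

/-!
# Route `UnitScaleTilt`, crux K1 «MinimiserStabilityRegPr» (stmt-QuantumFields-19200), route-R E′ (N06) LANE II (★★OWNER RULING №23), brick (C5-a) «LIFT TO A COVER»
# (★p1 g19 NAMER WORDS №1∕№3∕№5∕№7), FILES F4b + F5 of px12 g7's LOCATE `LOCATE-C5a-COVERLIFT-px12g7.md` (one module, two namespaces `…Prop7CoverQkc` then `…Prop7DivRecoveryOfCover`):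
# **PRINT'S COMB AVERAGING `Q(W) = QTw W` AND THE SLOT LETTER `Qkc W` ARE NATURAL UNDER THE `L^{jc}`-FOLD COVER ON `RegPr`** — the chain rule on FILE F4a's exact
# identity `logChartTw (F.cover jc) (W∘π) (A∘π) = (logChartTw F W A) ∘ π`, differentiability at `0` being a THEOREM on the printed-regular class (✓`hasFDerivAt_logChartTw` with
# ✓`hasFDerivAt_rel_of_regPr`, ✓`hasFDerivAt_frameTw_of_regPr`; px19 g6 (R2): off `RegPr` nothing is stated); hence **`ℓ³‖Qkc(W∘π)(X̃∘π)‖² = (L^{jc})³·ℓ³‖Qkc(W)X̃‖²`**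

Cell `ym3-torus` (HUMAN RULING D-0037, YM ladder rung R3 — YM₃ on T³ is a rung, NOT d = 4, NOT infinite volume, NOT a mass gap, NOT Clay; YM gap NOT proved), width seat
`ym3-torus-px12` (gen 7).  THEOREMS ONLY (0 `def`, 0 `sorry`); `--supports stmt-QuantumFields-19200 --as helper`; count-neutral.  Mathlib chain rule + FILE F4a + ✓`Prop7SymAvgTwBridge` +
✓`Prop7ChartWindows` (one window `10⁹·L³·e ≤ 1` feeds the four of ✓`QTw_apply_eq_of_regPr`); nothing of (V3)∕`hN06`∕the crux is claimed.

References: T. Bałaban, CMP 99 (1985) 389–434 [Balaban1985BackgroundPropagators] ((3.13)–(3.16) p.393); CMP 102 (1985) 277–309 [Balaban1985Variational] ((44)–(45) p.285, (6) p.278);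
CMP 109 (1987) 249–301 [Balaban1987RG1] ((0.1)–(0.2) pp.251–252).
-/

noncomputable section

open scoped InnerProductSpace Matrix.Norms.L2Operator BigOperators

namespace Summit.QuantumFields.YangMills.Theorems.Prop7CoverQkc

open Literature.MathematicalPhysics.QuantumFieldTheory.Balaban1983to89
open Literature.MathematicalPhysics.QuantumFieldTheory.Balaban1983to89.T3ContinuumYM3Torus
open T3PrintedRegularMinimiser (RegPr)
open T3SectALandauChart (bgUnits eta eta_pos)
open B7Prop2Explicit (C0 c2')
open CoverSites
open Summit.QuantumFields.YangMills.Theorems.Prop7SectET3Transport (periodsT3)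
open Summit.QuantumFields.YangMills.Theorems.Prop7SectET3HilbertLetters (W₂ toL2 toL2B inner_toL2B)
open Summit.QuantumFields.YangMills.Theorems.Prop7SymAvgTw (logChartTw QTw)
open Summit.QuantumFields.YangMills.Theorems.Prop7SymAvgTwBridge (hasFDerivAt_logChartTw)
open Summit.QuantumFields.YangMills.Theorems.Prop7SymAvgRelDiffT3 (hasFDerivAt_rel_of_regPr)
open Summit.QuantumFields.YangMills.Theorems.Prop7SymAvgTwFrameDiff (hasFDerivAt_frameTw_of_regPr)
open Summit.QuantumFields.YangMills.Theorems.Prop7SectET3CombLetters (Qkc Qkc_toL2)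
open Summit.QuantumFields.YangMills.Theorems.Prop7CoverTwistedChart (logChartTw_cover)
open Summit.QuantumFields.YangMills.Theorems.Prop7CoverHilbertPullback (sum_bond_comp_projBond degree_cast)
open Summit.QuantumFields.YangMills.Theorems.Prop7ChartWindows (three_le_L exp_member_le windowsS_of_small d_cast)
open Summit.QuantumFields.YangMills.Theorems.SmallMembersCoverLift (regPr_cover_iff)

variable (F : T3Family) (jc : ℕ) {n K : ℕ} (h : n ≤ K)

/-! ## §1 One window for the four of ✓`QTw_apply_eq_of_regPr` -/

omit h in
/-- ★ **THE FOUR WINDOWS OF THE TWISTED-CHART DIFFERENTIABILITY FROM ONE**: `10⁹·L³·e ≤ 1`, `0 < e` ⇒ `10⁷L³e ≤ 1`, `C0 d·(2e) ≤ 1∕3`, `4(2e) ≤ c2′ d L`, `exp(…·2e) < 2` (d = 3, L ≥ 3).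
[cite: Balaban1985Averaging, (51) p.26, (77)-(87) pp.30-31] -/
theorem windows_of_small {e : ℝ} (he : 0 < e) (hw : 10 ^ 9 * (F.L : ℝ) ^ 3 * e ≤ 1) :
    10 ^ 7 * (F.L : ℝ) ^ 3 * e ≤ 1 ∧ C0 (F.P K).d * (2 * e) ≤ 1 / 3 ∧ 4 * (2 * e) ≤ c2' (F.P K).d (F.P K).L ∧
      Real.exp (4 * (800 * (((F.P K).d : ℝ) + 1) ^ 2 * (((F.P K).d : ℝ) + 4)) * (2 * e)) < 2 := by
  have hL3 : (3 : ℝ) ≤ (F.L : ℝ) := three_le_L F K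
  have hL3' : (3 : ℝ) ≤ ((F.P K).L : ℝ) := three_le_L F K
  have hLF : (((F.P K).L : ℕ) : ℝ) = (F.L : ℝ) := rfl
  have hL27 : (27 : ℝ) ≤ (F.L : ℝ) ^ 3 := by
    have h3 := pow_le_pow_left₀ (by norm_num : (0 : ℝ) ≤ 3) hL3 3
    norm_num at h3
    exact h3
  have h1 : 10 ^ 7 * (F.L : ℝ) ^ 3 * e ≤ 1 := by nlinarith
  have heL2 : e * ((F.P K).L : ℝ) ^ 2 ≤ 1 / 10 ^ 9 := by
    rw [hLF]
    have hL1 : (1 : ℝ) ≤ (F.L : ℝ) := by linarith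
    have : e * (F.L : ℝ) ^ 2 ≤ e * (F.L : ℝ) ^ 3 := by
      have := mul_le_mul_of_nonneg_left (show (F.L : ℝ) ^ 2 ≤ (F.L : ℝ) ^ 3 by nlinarith) he.le
      linarith
    have h2 : e * (F.L : ℝ) ^ 3 ≤ 1 / 10 ^ 9 := by
      rw [le_div_iff₀ (by norm_num)]; nlinarith
    linarith
  obtain ⟨hα3, hα4, -, -, -, -, -, -, -⟩ := windowsS_of_small F K he he heL2 heL2
  have hsmall : 716800 * e ≤ 1 / 4 := by nlinarith
  have hexp := exp_member_le F K he.le hsmall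
  refine ⟨h1, hα3, hα4, ?_⟩
  have hexp' : Real.exp (4 * (800 * (((F.P K).d : ℝ) + 1) ^ 2 * (((F.P K).d : ℝ) + 4)) * (2 * e)) ≤ 3 / 2 := hexp
  linarith

/-- **THE TWISTED CHART IS DIFFERENTIABLE AT `0` ON THE PRINTED-REGULAR CLASS** (the two rows of ✓`hasFDerivAt_logChartTw` discharged by ✓`hasFDerivAt_rel_of_regPr` ∕ ✓`hasFDerivAt_frameTw_of_regPr`).
[cite: Balaban1985BackgroundPropagators, (3.14) p.393; Balaban1985Variational, (6) p.278] -/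
theorem differentiableAt_logChartTw_of_regPr {e : ℝ} (he : 0 < e) (hw : 10 ^ 9 * (F.L : ℝ) ^ 3 * e ≤ 1)
    (W : GaugeField (F.P K) 0 (Matrix.specialUnitaryGroup (Fin 2) ℂ)) (hreg : RegPr F n K e W) :
    DifferentiableAt ℂ (logChartTw F n K h W) 0 := by
  obtain ⟨h1, hα3, hα4, hexp⟩ := windows_of_small F (K := K) he hw
  exact (hasFDerivAt_logChartTw F h W (hasFDerivAt_rel_of_regPr F h he h1 W hreg) (hasFDerivAt_frameTw_of_regPr F h he hα3 hα4 hexp W hreg)).differentiableAt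

/-! ## §2 The chain rule: `QTw (F.cover jc) (W∘π) (A∘π) = (QTw F W A) ∘ π` on `RegPr` -/

/-- ★★★ **PRINT'S COMB AVERAGING OF THE LIFT IS THE LIFT OF THE COMB AVERAGING** at a printed-regular background (`10⁹L³e ≤ 1`): `QTw (F.cover jc) (W∘π) (A∘π) = (QTw F W A) ∘ π` —
the Fréchet derivative at `0` of FILE F4a's identity `logChartTw′ ∘ (·∘π) = (·∘π) ∘ logChartTw` (both charts differentiable at `0` on `RegPr`, ✓`regPr_cover_iff`).
[cite: Balaban1985BackgroundPropagators, (3.14)-(3.15) p.393; Balaban1985Variational, (44) p.285; Balaban1987RG1, (0.1) p.251] -/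
theorem QTw_cover {e : ℝ} (he : 0 < e) (hw : 10 ^ 9 * (F.L : ℝ) ^ 3 * e ≤ 1)
    (W : GaugeField (F.P K) 0 (Matrix.specialUnitaryGroup (Fin 2) ℂ)) (hreg : RegPr F n K e W) (A : PBond (F.P K) 0 → Matrix (Fin 2) (Fin 2) ℂ) :
    QTw (F.cover jc) n K h (W ∘ projBond (F.P K) jc 0) (A ∘ projBond (F.P K) jc 0) = QTw F n K h W A ∘ projBond (F.P n) jc 0 := by
  -- the two pullbacks as continuous linear maps
  let Pf : (PBond (F.P K) 0 → Matrix (Fin 2) (Fin 2) ℂ) →L[ℂ] (PBond ((F.cover jc).P K) 0 → Matrix (Fin 2) (Fin 2) ℂ) :=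
    LinearMap.toContinuousLinearMap (LinearMap.funLeft ℂ (Matrix (Fin 2) (Fin 2) ℂ) (projBond (F.P K) jc 0))
  let Pc : (PBond (F.P n) 0 → Matrix (Fin 2) (Fin 2) ℂ) →L[ℂ] (PBond ((F.cover jc).P n) 0 → Matrix (Fin 2) (Fin 2) ℂ) :=
    LinearMap.toContinuousLinearMap (LinearMap.funLeft ℂ (Matrix (Fin 2) (Fin 2) ℂ) (projBond (F.P n) jc 0))
  have hPf : ∀ B, Pf B = B ∘ projBond (F.P K) jc 0 := fun B => rfl
  have hPc : ∀ C, Pc C = C ∘ projBond (F.P n) jc 0 := fun C => rfl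
  -- F4a: the charts agree as functions
  have hfun : (logChartTw (F.cover jc) n K h (W ∘ projBond (F.P K) jc 0)) ∘ Pf = Pc ∘ logChartTw F n K h W := by
    funext B
    rw [Function.comp_apply, Function.comp_apply, hPf, hPc]
    exact logChartTw_cover F jc h W B
  -- differentiability at `0` of both charts
  have hdF : DifferentiableAt ℂ (logChartTw F n K h W) 0 := differentiableAt_logChartTw_of_regPr F h he hw W hreg
  have hreg' : RegPr (F.cover jc) n K e (W ∘ projBond (F.P K) jc 0) := (regPr_cover_iff jc F e W).2 hreg
  have hdC : DifferentiableAt ℂ (logChartTw (F.cover jc) n K h (W ∘ projBond (F.P K) jc 0)) (Pf 0) := by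
    rw [map_zero]
    exact differentiableAt_logChartTw_of_regPr (F.cover jc) h he hw (W ∘ projBond (F.P K) jc 0) hreg'
  -- chain rule on both sides of `hfun`
  have hL : fderiv ℂ ((logChartTw (F.cover jc) n K h (W ∘ projBond (F.P K) jc 0)) ∘ Pf) 0
      = (fderiv ℂ (logChartTw (F.cover jc) n K h (W ∘ projBond (F.P K) jc 0)) 0).comp Pf := by
    rw [fderiv_comp 0 hdC Pf.differentiableAt, Pf.fderiv, map_zero]
  have hR : fderiv ℂ (Pc ∘ logChartTw F n K h W) 0 = Pc.comp (fderiv ℂ (logChartTw F n K h W) 0) := by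
    rw [fderiv_comp 0 (by exact Pc.differentiableAt) hdF, Pc.fderiv]
  have key : (fderiv ℂ (logChartTw (F.cover jc) n K h (W ∘ projBond (F.P K) jc 0)) 0).comp Pf = Pc.comp (fderiv ℂ (logChartTw F n K h W) 0) := by
    rw [← hL, ← hR, hfun]
  have := congrArg (fun T : (PBond (F.P K) 0 → Matrix (Fin 2) (Fin 2) ℂ) →L[ℂ] (PBond ((F.cover jc).P n) 0 → Matrix (Fin 2) (Fin 2) ℂ) => T A) key
  simp only [ContinuousLinearMap.comp_apply, hPf, hPc] at this
  exact this

/-! ## §3 The slot letter `Qkc` and its degree identity -/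

variable {c₀ cB : ℝ} [Fact (0 < c₀)] [Fact (0 < cB)]

omit h in
/-- ★ **`‖B̃∘π‖² = (L^{jc})³·‖B̃‖²`** on the coarse block fields (`toL2B`, weight `cB`). [cite: Balaban1985BackgroundPropagators, (3.16) p.393; Balaban1987RG1, (0.2) p.252] -/
theorem norm_sq_toL2B_cover (B : PBond (F.P n) 0 → Matrix (Fin 2) (Fin 2) ℂ) :
    ‖toL2B (F.cover jc) n cB (B ∘ projBond (F.P n) jc 0)‖ ^ 2 = ((F.L : ℝ) ^ jc) ^ 3 * ‖toL2B F n cB B‖ ^ 2 := by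
  rw [Prop7LaplaceAFlatLetters.norm_sq_toL2B, Prop7LaplaceAFlatLetters.norm_sq_toL2B]
  have hsum : (∑ ct : PBond ((F.cover jc).P n) 0, ∑ i : Fin 2, ∑ i' : Fin 2, ‖(B ∘ projBond (F.P n) jc 0) ct i i'‖ ^ 2)
      = ((F.L ^ jc) ^ 3) • ∑ c : PBond (F.P n) 0, ∑ i : Fin 2, ∑ i' : Fin 2, ‖B c i i'‖ ^ 2 :=
    sum_bond_comp_projBond F jc n (fun c => ∑ i : Fin 2, ∑ i' : Fin 2, ‖B c i i'‖ ^ 2)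
  exact (congrArg (fun t : ℝ => cB * t) hsum).trans (by rw [nsmul_eq_mul, degree_cast]; ring)

omit [Fact (0 < c₀)] [Fact (0 < cB)] in
/-- ★★★ **THE SLOT LETTER OF THE LIFT**: `Qkc (F.cover jc) (W∘π) (X̃∘π) = η • toL2B′ ((QTw F W X) ∘ π)` on `RegPr`. [cite: Balaban1985Variational, (44)-(45) p.285; Balaban1987RG1, (0.1) p.251] -/
theorem Qkc_cover {e : ℝ} (he : 0 < e) (hw : 10 ^ 9 * (F.L : ℝ) ^ 3 * e ≤ 1)
    (W : GaugeField (F.P K) 0 (Matrix.specialUnitaryGroup (Fin 2) ℂ)) (hreg : RegPr F n K e W) (X : PBond (F.P K) 0 → Matrix (Fin 2) (Fin 2) ℂ) :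
    Qkc (F.cover jc) n K h c₀ cB (W ∘ projBond (F.P K) jc 0) (toL2 (F.cover jc) K c₀ (X ∘ projBond (F.P K) jc 0))
      = (((eta F n K : ℝ) : ℂ)) • toL2B (F.cover jc) n cB (QTw F n K h W X ∘ projBond (F.P n) jc 0) := by
  rw [Qkc_toL2, QTw_cover F jc h he hw W hreg X]
  rfl

omit [Fact (0 < c₀)] in
/-- ★★★ **THE AVERAGING SLOT SCALES BY THE DEGREE**: `ℓ³·‖Qkc(W∘π)(X̃∘π)‖² = (L^{jc})³ · ℓ³·‖Qkc(W)X̃‖²` (`10⁹L³e ≤ 1`, `W ∈ RegPr F n K e`).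
[cite: Balaban1985BackgroundPropagators, (3.14)-(3.16) p.393; Balaban1987RG1, (0.2) p.252] -/
theorem norm_sq_Qkc_cover {e : ℝ} (he : 0 < e) (hw : 10 ^ 9 * (F.L : ℝ) ^ 3 * e ≤ 1)
    (W : GaugeField (F.P K) 0 (Matrix.specialUnitaryGroup (Fin 2) ℂ)) (hreg : RegPr F n K e W) (X : PBond (F.P K) 0 → Matrix (Fin 2) (Fin 2) ℂ) :
    ((F.L : ℝ) ^ (K - n)) ^ 3 * ‖Qkc (F.cover jc) n K h c₀ cB (W ∘ projBond (F.P K) jc 0) (toL2 (F.cover jc) K c₀ (X ∘ projBond (F.P K) jc 0))‖ ^ 2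
      = ((F.L : ℝ) ^ jc) ^ 3 * (((F.L : ℝ) ^ (K - n)) ^ 3 * ‖Qkc F n K h c₀ cB W (toL2 F K c₀ X)‖ ^ 2) := by
  rw [Qkc_cover F jc h he hw W hreg X, Qkc_toL2, norm_smul, norm_smul, mul_pow, mul_pow, norm_sq_toL2B_cover]
  ring

end Summit.QuantumFields.YangMills.Theorems.Prop7CoverQkc

end

/-!
# Route `UnitScaleTilt`, crux K1 «MinimiserStabilityRegPr» (stmt-QuantumFields-19200), route-R E′ (N06) LANE II (★★OWNER RULING №23), brick (C5-a) «LIFT TO A COVER»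
# (★p1 g19 NAMER WORDS №1∕№3∕№5 «(C5-a) := px12 g7 — GO»), FILE F5 of px12 g7's LOCATE `LOCATE-C5a-COVERLIFT-px12g7.md`:
# **THE DIVERGENCE-RECOVERY ROW TRANSFERS FROM THE `L^{jc}`-FOLD COVER TO THE MEMBER** — (T-point) the ✓p702330 `hRec`-inequality at `(F.cover jc, W∘π, X̃∘π)` gives it at
# `(F, W, X̃)` with the SAME constants (every displayed slot is `(L^{jc})³` times the member's: FILES F2b∕F3∕F4b); (T-row) hence the row proved for all members whose torus is
# LARGE (`s < m + n`, the (B6) p.o.u. proviso) gives ✓`Prop7HcoOfDivRecovery.hCo_of_divRecovery`'s `hRec` VERBATIM, for EVERY member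

Cell `ym3-torus` (HUMAN RULING D-0037, YM ladder rung R3 — YM₃ on T³ is a rung, NOT d = 4, NOT infinite volume, NOT a mass gap, NOT Clay; YM gap NOT proved), width seat
`ym3-torus-px12` (gen 7).  THEOREMS ONLY (0 `def`, 0 `sorry`); `--supports stmt-QuantumFields-19200 --as helper`; count-neutral.  A TRANSFER: the large-torus row is a HYPOTHESIS (lane II's
(B6)+(B7), OPEN); nothing of (V3)∕`hN06`∕the crux is proved here.  The radius shrinks by the one window `e ≤ (10⁹L³)⁻¹` of FILE F4b (the chart's differentiability on `RegPr`).

References: T. Bałaban, CMP 99 (1985) 389–434 [Balaban1985BackgroundPropagators] ((3.20)–(3.26) pp.394–395, Thm 3.11 p.416); CMP 96 (1984) 223–250 [Balaban1984PropagatorsII]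
((2.15)–(2.19) pp.225–226); CMP 102 (1985) 277–309 [Balaban1985Variational] ((144) p.300 — all torus sizes); CMP 109 (1987) 249–301 [Balaban1987RG1] ((0.1)–(0.2) pp.251–252).
-/

noncomputable section

open scoped InnerProductSpace Matrix.Norms.L2Operator BigOperators

namespace Summit.QuantumFields.YangMills.Theorems.Prop7DivRecoveryOfCover

open Literature.MathematicalPhysics.QuantumFieldTheory.Balaban1983to89
open Literature.MathematicalPhysics.QuantumFieldTheory.Balaban1983to89.T3ContinuumYM3Torus
open T3PrintedRegularMinimiser (RegPr)
open B11Eq103H1Complex (BondL2K)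
open CoverSites
open Summit.QuantumFields.YangMills.Theorems.Prop7SectET3Transport (periodsT3)
open Summit.QuantumFields.YangMills.Theorems.Prop7SectET3HilbertLetters (W₂ toL2 DstarL2)
open Summit.QuantumFields.YangMills.Theorems.Prop7SectET3WilsonHessian (DeltaEtaSlot)
open Summit.QuantumFields.YangMills.Theorems.Prop7SectET3CombLetters (Qkc)
open Summit.QuantumFields.YangMills.Theorems.Prop7QprimeCombL2 (RcombL2)
open Summit.QuantumFields.YangMills.Theorems.Prop7CoverHilbertPullback (norm_sq_toL2_cover norm_sq_DstarL2_cover re_inner_DeltaEtaSlot_cover)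
open Summit.QuantumFields.YangMills.Theorems.Prop7CoverCombLetters (norm_sq_RcombL2_DstarL2_cover)
open Summit.QuantumFields.YangMills.Theorems.Prop7CoverQkc (norm_sq_Qkc_cover)
open Summit.QuantumFields.YangMills.Theorems.SmallMembersCoverLift (regPr_cover_iff)

variable (c₀ cB a₀ : ℕ → ℝ) [hc₀ : ∀ L : ℕ, Fact (0 < c₀ L)] [hcB : ∀ L : ℕ, Fact (0 < cB L)]

/-! ## §1 (T-point): the row at the cover member gives the row at the member, same constants -/

/-- ★★★ **(T-point) THE DIVERGENCE-RECOVERY INEQUALITY DESCENDS FROM THE COVER**: at a printed-regular `W` with `10⁹L³e ≤ 1`, if the `hRec`-inequality of ✓`hCo_of_divRecovery` holds at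
`(F.cover jc, W ∘ π, toL2 (X ∘ π))` with constants `C, s`, it holds at `(F, W, toL2 X)` with the same `C, s`: every slot is `(L^{jc})³` times the member's (✓F2b `norm_sq_DstarL2_cover`,
`re_inner_DeltaEtaSlot_cover`, `norm_sq_toL2_cover`; ✓F3 `norm_sq_RcombL2_DstarL2_cover`; ✓F4b `norm_sq_Qkc_cover`). [cite: Balaban1985BackgroundPropagators, (3.20)-(3.26) pp.394-395; Balaban1987RG1, (0.2) p.252] -/
theorem divRecovery_at_of_cover (F : T3Family) (jc : ℕ) {n K : ℕ} (hnK : n < K) {e : ℝ} (he : 0 < e) (hw : 10 ^ 9 * (F.L : ℝ) ^ 3 * e ≤ 1)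
    (W : GaugeField (F.P K) 0 (Matrix.specialUnitaryGroup (Fin 2) ℂ)) (hreg : RegPr F n K e W) (X : PBond (F.P K) 0 → Matrix (Fin 2) (Fin 2) ℂ) {C s : ℝ}
    (hcov : ‖DstarL2 (F.cover jc) n K (c₀ F.L) (W ∘ projBond (F.P K) jc 0) (toL2 (F.cover jc) K (c₀ F.L) (X ∘ projBond (F.P K) jc 0))‖ ^ 2
      ≤ C * (‖RcombL2 (F.cover jc) n K (c₀ F.L) (W ∘ projBond (F.P K) jc 0)
                (DstarL2 (F.cover jc) n K (c₀ F.L) (W ∘ projBond (F.P K) jc 0) (toL2 (F.cover jc) K (c₀ F.L) (X ∘ projBond (F.P K) jc 0)))‖ ^ 2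
            + (a₀ F.L * (c₀ F.L / cB F.L) * ((F.L : ℝ) ^ (K - n)) ^ 3)
                * ‖Qkc (F.cover jc) n K hnK.le (c₀ F.L) (cB F.L) (W ∘ projBond (F.P K) jc 0) (toL2 (F.cover jc) K (c₀ F.L) (X ∘ projBond (F.P K) jc 0))‖ ^ 2
            + RCLike.re ⟪toL2 (F.cover jc) K (c₀ F.L) (X ∘ projBond (F.P K) jc 0),
                DeltaEtaSlot (F.cover jc) n K (c₀ F.L) (W ∘ projBond (F.P K) jc 0) (toL2 (F.cover jc) K (c₀ F.L) (X ∘ projBond (F.P K) jc 0))⟫_ℂ)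
          + s * ‖toL2 (F.cover jc) K (c₀ F.L) (X ∘ projBond (F.P K) jc 0)‖ ^ 2) :
    ‖DstarL2 F n K (c₀ F.L) W (toL2 F K (c₀ F.L) X)‖ ^ 2
      ≤ C * (‖RcombL2 F n K (c₀ F.L) W (DstarL2 F n K (c₀ F.L) W (toL2 F K (c₀ F.L) X))‖ ^ 2
            + (a₀ F.L * (c₀ F.L / cB F.L) * ((F.L : ℝ) ^ (K - n)) ^ 3) * ‖Qkc F n K hnK.le (c₀ F.L) (cB F.L) W (toL2 F K (c₀ F.L) X)‖ ^ 2
            + RCLike.re ⟪toL2 F K (c₀ F.L) X, DeltaEtaSlot F n K (c₀ F.L) W (toL2 F K (c₀ F.L) X)⟫_ℂ)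
          + s * ‖toL2 F K (c₀ F.L) X‖ ^ 2 := by
  haveI : Fact (0 < c₀ F.L) := hc₀ F.L
  haveI : Fact (0 < cB F.L) := hcB F.L
  have hQ := norm_sq_Qkc_cover F jc hnK.le (c₀ := c₀ F.L) (cB := cB F.L) he hw W hreg X
  have hQ' : (a₀ F.L * (c₀ F.L / cB F.L) * ((F.L : ℝ) ^ (K - n)) ^ 3)
        * ‖Qkc (F.cover jc) n K hnK.le (c₀ F.L) (cB F.L) (W ∘ projBond (F.P K) jc 0) (toL2 (F.cover jc) K (c₀ F.L) (X ∘ projBond (F.P K) jc 0))‖ ^ 2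
      = ((F.L : ℝ) ^ jc) ^ 3 * ((a₀ F.L * (c₀ F.L / cB F.L) * ((F.L : ℝ) ^ (K - n)) ^ 3) * ‖Qkc F n K hnK.le (c₀ F.L) (cB F.L) W (toL2 F K (c₀ F.L) X)‖ ^ 2) := by
    linear_combination (a₀ F.L * (c₀ F.L / cB F.L)) * hQ
  rw [norm_sq_DstarL2_cover, norm_sq_RcombL2_DstarL2_cover F jc n K (c₀ F.L) hnK.le, hQ', re_inner_DeltaEtaSlot_cover, norm_sq_toL2_cover] at hcov
  have hD : (0 : ℝ) < ((F.L : ℝ) ^ jc) ^ 3 := by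
    have hL : (0 : ℝ) < F.L := by have := F.hL.2; exact_mod_cast (by omega : 0 < F.L)
    positivity
  have key : ((F.L : ℝ) ^ jc) ^ 3 * ‖DstarL2 F n K (c₀ F.L) W (toL2 F K (c₀ F.L) X)‖ ^ 2
      ≤ ((F.L : ℝ) ^ jc) ^ 3 * (C * (‖RcombL2 F n K (c₀ F.L) W (DstarL2 F n K (c₀ F.L) W (toL2 F K (c₀ F.L) X))‖ ^ 2
            + (a₀ F.L * (c₀ F.L / cB F.L) * ((F.L : ℝ) ^ (K - n)) ^ 3) * ‖Qkc F n K hnK.le (c₀ F.L) (cB F.L) W (toL2 F K (c₀ F.L) X)‖ ^ 2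
            + RCLike.re ⟪toL2 F K (c₀ F.L) X, DeltaEtaSlot F n K (c₀ F.L) W (toL2 F K (c₀ F.L) X)⟫_ℂ)
          + s * ‖toL2 F K (c₀ F.L) X‖ ^ 2) := by
    linear_combination hcov
  exact le_of_mul_le_mul_left key hD

/-! ## §2 (T-row): the row for LARGE members gives the row of record for EVERY member -/

/-- The window `e ≤ (10⁹L³)⁻¹` as `10⁹L³e ≤ 1`. [folklore] -/
theorem window_of_le {L : ℕ} (hL : 1 < L) {e : ℝ} (he : e ≤ (10 ^ 9 * (L : ℝ) ^ 3)⁻¹) : 10 ^ 9 * (L : ℝ) ^ 3 * e ≤ 1 := by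
  have hpos : (0 : ℝ) < 10 ^ 9 * (L : ℝ) ^ 3 := by
    have : (0 : ℝ) < L := by exact_mod_cast (by omega : 0 < L)
    positivity
  calc 10 ^ 9 * (L : ℝ) ^ 3 * e ≤ 10 ^ 9 * (L : ℝ) ^ 3 * (10 ^ 9 * (L : ℝ) ^ 3)⁻¹ := mul_le_mul_of_nonneg_left he hpos.le
    _ = 1 := mul_inv_cancel₀ hpos.ne'

/-- ★★★ **(T-row) THE DIVERGENCE-RECOVERY ROW OF RECORD FROM ITS LARGE-TORUS VERSION**: if for every `L > 1`, `δ > 0` there are `C, C′ ≥ 0`, `eR > 0` and a size `s` such that the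
`hRec`-inequality holds at every member with `s < m + n` (the (B6) p.o.u. proviso: `L^s`-patches fit `2L^{m+n}` blocks per direction), then ✓`hCo_of_divRecovery`'s `hRec` holds VERBATIM
(EVERY member; radius `min eR (10⁹L³)⁻¹`): a small member is lifted to its `L^{s+1}`-fold cover (`(F.cover (s+1)).m = m + s + 1`), the row there descends by (T-point).
[cite: Balaban1985BackgroundPropagators, (3.20)-(3.26) pp.394-395; Balaban1985Variational, (144) p.300; Balaban1987RG1, (0.1)-(0.2) pp.251-252] -/
theorem hRec_of_large
    (hLarge : ∀ (L : ℕ), 1 < L → ∀ δ : ℝ, 0 < δ → ∃ C C' eR : ℝ, ∃ s : ℕ, 0 ≤ C ∧ 0 ≤ C' ∧ 0 < eR ∧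
      ∀ (F : T3Family), F.L = L → ∀ (n K : ℕ) (hnK : n < K) (e : ℝ) (W : GaugeField (F.P K) 0 (Matrix.specialUnitaryGroup (Fin 2) ℂ)),
        s < F.m + n → 0 < e → e ≤ eR → RegPr F n K e W →
        ∀ y : BondL2K ℂ 3 (periodsT3 F K) (c₀ F.L) W₂,
          ‖DstarL2 F n K (c₀ F.L) W y‖ ^ 2
            ≤ C * (‖RcombL2 F n K (c₀ F.L) W (DstarL2 F n K (c₀ F.L) W y)‖ ^ 2
                  + (a₀ F.L * (c₀ F.L / cB F.L) * ((F.L : ℝ) ^ (K - n)) ^ 3) * ‖Qkc F n K hnK.le (c₀ F.L) (cB F.L) W y‖ ^ 2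
                  + RCLike.re ⟪y, DeltaEtaSlot F n K (c₀ F.L) W y⟫_ℂ)
              + (C' * e + δ) * ‖y‖ ^ 2) :
    ∀ (L : ℕ), 1 < L → ∀ δ : ℝ, 0 < δ → ∃ C C' eR : ℝ, 0 ≤ C ∧ 0 ≤ C' ∧ 0 < eR ∧
      ∀ (F : T3Family), F.L = L → ∀ (n K : ℕ) (hnK : n < K) (e : ℝ) (W : GaugeField (F.P K) 0 (Matrix.specialUnitaryGroup (Fin 2) ℂ)),
        0 < e → e ≤ eR → RegPr F n K e W →
        ∀ y : BondL2K ℂ 3 (periodsT3 F K) (c₀ F.L) W₂,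
          ‖DstarL2 F n K (c₀ F.L) W y‖ ^ 2
            ≤ C * (‖RcombL2 F n K (c₀ F.L) W (DstarL2 F n K (c₀ F.L) W y)‖ ^ 2
                  + (a₀ F.L * (c₀ F.L / cB F.L) * ((F.L : ℝ) ^ (K - n)) ^ 3) * ‖Qkc F n K hnK.le (c₀ F.L) (cB F.L) W y‖ ^ 2
                  + RCLike.re ⟪y, DeltaEtaSlot F n K (c₀ F.L) W y⟫_ℂ)
              + (C' * e + δ) * ‖y‖ ^ 2 := by
  intro L hL δ hδ
  obtain ⟨C, C', eR, s, hC, hC', heR, H⟩ := hLarge L hL δ hδ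
  have hwpos : (0 : ℝ) < (10 ^ 9 * (L : ℝ) ^ 3)⁻¹ := by
    have : (0 : ℝ) < L := by exact_mod_cast (by omega : 0 < L)
    positivity
  refine ⟨C, C', min eR (10 ^ 9 * (L : ℝ) ^ 3)⁻¹, hC, hC', lt_min heR hwpos, ?_⟩
  intro F hF n K hnK e W he heR' hreg y
  have heR : e ≤ eR := heR'.trans (min_le_left _ _)
  by_cases hs : s < F.m + n
  · exact H F hF n K hnK e W hs he heR hreg y
  · -- lift to the `L^{s+1}`-fold cover
    haveI : Fact (0 < c₀ F.L) := hc₀ F.L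
    have hw : 10 ^ 9 * (F.L : ℝ) ^ 3 * e ≤ 1 := by rw [hF]; exact window_of_le hL (heR'.trans (min_le_right _ _))
    obtain ⟨X, rfl⟩ := (toL2 F K (c₀ F.L)).surjective y
    have hFL : (F.cover (s + 1)).L = L := hF
    have hs' : s < (F.cover (s + 1)).m + n := by show s < F.m + (s + 1) + n; omega
    have hreg' : RegPr (F.cover (s + 1)) n K e (W ∘ projBond (F.P K) (s + 1) 0) := (regPr_cover_iff (s + 1) F e W).2 hreg
    have hcov := H (F.cover (s + 1)) hFL n K hnK e (W ∘ projBond (F.P K) (s + 1) 0) hs' he heR hreg'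
      (toL2 (F.cover (s + 1)) K (c₀ F.L) (X ∘ projBond (F.P K) (s + 1) 0))
    exact divRecovery_at_of_cover c₀ cB a₀ F (s + 1) hnK he hw W hreg X hcov

end Summit.QuantumFields.YangMills.Theorems.Prop7DivRecoveryOfCover

end
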